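import Mathlib
import HarnessLib
import Summits.NavierStokesRegularity.NavierStokesRegularity.Theorems.PoloidalWindowDoorPoloidalWindowRigiditySparseEnergyPowerWeights

/-!
# Route `PoloidalWindowDoor`, crux `PoloidalWindowRigidity` (stmt-19708), line `sparse_energy` (cstrat g11) —
# stub S1 `stub_scaledEnergy`, near-apex bootstrap: POWER-LAW ENVELOPES at rescaled radii and through the dyadic far-field sum

Seat ns-poloidal-K2-p2 g9 (successor of the interim LEAD-of-record on 19708; file `--supports`).  In each round of the near-apex bootstrap
(S1-NEAR-DESIGN-K2p2-g9 addendum) the induction hypothesis `E(a,ρ,t) ≤ Φ_γ(ρ,t) := K ρ (ρ²/(−t))^γ` (near regime) is inserted into the flux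
majorant of `…SparseEnergyNearFlux.abs_flux_le_near` at the radii `2R`, `8R` and `2^{k+1}R` (far-field pressure, summed over `k`).  This file is the
envelope algebra, free of measure theory:

* `envelope_smul_radius` — `Φ_γ(λR, t) = λ^{1+2γ} · Φ_γ(R, t)` (`λ, R, −t > 0`);
* `hasSum_envelope_dyadic` — `Σ_k (2^k R)⁻⁴ Φ_γ(2^{k+1}R, t) = (2^{1+2γ}/(1 − 2^{2γ−3})) · R⁻⁴ Φ_γ(R,t)` for `γ < 3/2` (from `tsum_dyadic_shell`, `p = 1 + 2γ`);
* `envelope_weaken` — on the near regime `x = ρ²/(−t) ≥ 1`, `γ ≤ γ'` ⇒ `Φ_γ ≤ Φ_{γ'}·(K/K')⁻¹…`, precisely `K ρ x^γ ≤ K ρ x^{γ'}`;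
* `one_add_log_add_sqrt_le` — the round-1 weakening `1 + log x + √x ≤ (18/5)·x^{5/8}` for `x ≥ 1` (`log x ≤ (8/5)x^{5/8}`, `1 ≤ x^{5/8}`, `√x ≤ x^{5/8}`).

WHAT THIS IS NOT: not a claim about Navier–Stokes — real algebra (bears_on LADDER-NS N0 via crux 19708, line sparse_energy, stub S1). [folklore]
-/

noncomputable section

-- the summit and its single sub-problem share the name (CONVENTIONS §1), as in every Theorems file
set_option linter.dupNamespace false

namespace Summit.NavierStokesRegularity.NavierStokesRegularity.Theorems.PoloidalWindowDoorPoloidalWindowRigiditySparseEnergyEnvelope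

open Summit.NavierStokesRegularity.NavierStokesRegularity.Theorems.PoloidalWindowDoorPoloidalWindowRigiditySparseEnergyPowerWeights

/-- **Rescaling the radius in a power envelope**: `K(λR)((λR)²/(−t))^γ = λ^{1+2γ} · K R (R²/(−t))^γ`. [folklore] -/
theorem envelope_smul_radius (K γ : ℝ) {lam R τ : ℝ} (hlam : 0 < lam) (hR : 0 < R) (hτ : 0 < τ) :
    K * (lam * R) * ((lam * R) ^ 2 / τ) ^ γ = lam ^ (1 + 2 * γ) * (K * R * (R ^ 2 / τ) ^ γ) := by
  have h1 : ((lam * R) ^ 2 / τ) = lam ^ 2 * (R ^ 2 / τ) := by ring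
  rw [h1, Real.mul_rpow (by positivity) (by positivity), Real.rpow_add hlam, Real.rpow_one,
    show (lam ^ 2 : ℝ) ^ γ = lam ^ (2 * γ) by rw [← Real.rpow_natCast lam 2, ← Real.rpow_mul hlam.le]; norm_num]
  ring

/-- **The dyadic far-field sum of a power envelope**: for `γ < 3/2`,
`Σ_k (2^k R)⁻⁴ · K (2^{k+1}R) ((2^{k+1}R)²/τ)^γ = (2^{1+2γ}/(1 − 2^{(1+2γ)−4})) · (R⁻⁴ · K R (R²/τ)^γ)`. [folklore] -/
theorem hasSum_envelope_dyadic (K : ℝ) {γ R τ : ℝ} (hγ : γ < 3 / 2) (hR : 0 < R) (hτ : 0 < τ) :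
    HasSum (fun k : ℕ => ((2 : ℝ) ^ k * R)⁻¹ ^ 4 * (K * ((2 : ℝ) ^ (k + 1) * R) * ((((2 : ℝ) ^ (k + 1) * R) ^ 2 / τ) ^ γ)))
      ((2 : ℝ) ^ (1 + 2 * γ) / (1 - (2 : ℝ) ^ ((1 + 2 * γ) - 4)) * ((R⁻¹) ^ 4 * (K * R * (R ^ 2 / τ) ^ γ))) := by
  have hp : 1 + 2 * γ < 4 := by linarith
  have h := (tsum_dyadic_shell hp).mul_right ((R⁻¹) ^ 4 * (K * R * (R ^ 2 / τ) ^ γ))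
  refine h.congr_fun fun k => ?_
  have h2k : (0 : ℝ) < (2 : ℝ) ^ (k + 1) := pow_pos two_pos _
  rw [envelope_smul_radius K γ h2k hR hτ]
  have e4 : (((2 : ℝ) ^ k) ^ (4 : ℝ))⁻¹ = (((2 : ℝ) ^ k)⁻¹) ^ 4 := by
    rw [show ((2 : ℝ) ^ k) ^ (4 : ℝ) = ((2 : ℝ) ^ k) ^ (4 : ℕ) by exact_mod_cast Real.rpow_natCast ((2 : ℝ) ^ k) 4, inv_pow]
  rw [e4, mul_inv, mul_pow]
  ring

/-- **Weakening a power envelope on the near regime**: for `x ≥ 1` and `γ ≤ γ'`, `x^γ ≤ x^{γ'}`, hence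
`K ρ x^γ ≤ K ρ x^{γ'}` for `K, ρ ≥ 0`. [folklore] -/
theorem envelope_weaken {K ρ x γ γ' : ℝ} (hK : 0 ≤ K) (hρ : 0 ≤ ρ) (hx : 1 ≤ x) (hγ : γ ≤ γ') :
    K * ρ * x ^ γ ≤ K * ρ * x ^ γ' :=
  mul_le_mul_of_nonneg_left (Real.rpow_le_rpow_of_exponent_le hx hγ) (mul_nonneg hK hρ)

/-- **The round-1 weakening**: `1 + log x + √x ≤ (18/5) · x^{5/8}` for `x ≥ 1`. [folklore] -/
theorem one_add_log_add_sqrt_le {x : ℝ} (hx : 1 ≤ x) :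
    1 + Real.log x + Real.sqrt x ≤ 18 / 5 * x ^ (5 / 8 : ℝ) := by
  have hx0 : 0 < x := lt_of_lt_of_le one_pos hx
  have h1 : (1 : ℝ) ≤ x ^ (5 / 8 : ℝ) := Real.one_le_rpow hx (by norm_num)
  have h2 : Real.log x ≤ x ^ (5 / 8 : ℝ) / (5 / 8) := log_le_rpow_div hx0 (by norm_num)
  have h3 : Real.sqrt x ≤ x ^ (5 / 8 : ℝ) := by
    rw [Real.sqrt_eq_rpow]
    exact Real.rpow_le_rpow_of_exponent_le hx (by norm_num)
  have e : x ^ (5 / 8 : ℝ) / (5 / 8) = 8 / 5 * x ^ (5 / 8 : ℝ) := by ring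
  rw [e] at h2
  linarith

end Summit.NavierStokesRegularity.NavierStokesRegularity.Theorems.PoloidalWindowDoorPoloidalWindowRigiditySparseEnergyEnvelope

end
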